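import Summits.CriticalPhenomena.PercolationContinuityZ3.Theorems.PercNearOneGluingNoHeavyLowerTailSunflowerMultiPetalKempeChain
import Mathlib.Data.Sym.Sym2
import Mathlib.Data.Finset.Sym
import Mathlib.Data.Finset.Powerset
import Mathlib.Data.Finset.Card
import Mathlib.Algebra.BigOperators.Ring.Finset
import Mathlib.Algebra.BigOperators.Group.Finset.Powerset
import Mathlib.Algebra.BigOperators.Fin
import Mathlib.Tactic.NormNum
import Mathlib.Tactic.Linarith
import HarnessLib
import HarnessLib.Audit

/-!
# `NoHeavyLowerTail` (crux stmt-CriticalPhenomena-4575), Lemma B for graph clutters: the Lemma-B functional `Q(G)` in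
# COLOURING LANGUAGE and its POINTWISE NORMAL FORM by the shape of the monochromatic set

Support file (seat `prim-l12-p2` gen 40; `--supports stmt-CriticalPhenomena-4575`; continuation of `…SunflowerMultiPetalKempeChain`
(p403220/p403831), used by the companion `…SunflowerMultiPetalKempeIdentity`).  No `sorry`; nothing is asserted about the crux.
Memo: run/shared/lean/prim/prim-l12/prim-l12-p2/FINDING-g39b-KEMPE-IDENTITY-AND-LINKED-CONJECTURE.md §0, §3.

For a finite simple graph `G` and an arbitrary colouring `σ : V → Fin 3`, `monoSet G σ` is the set `M(σ)` of monochromatic edges,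
`cnt G σ c = X_c(σ)` the number of those of colour `c`, and `qcol G σ = 2·[0,0,2⁺] − [0,1,1] − [1,1,1]` the Lemma-B weight of the
capped type `(X_c ∧ 2)_c`; `Qcol G = Σ_σ qcol G σ` is the graph case of the bottom-spectator functional (`QKW univ (ofClutter E)` for the
edge family — that one-line bridge waits for the farm build of `…ClutterTypeVector`).  POINTWISE NORMAL FORM (`three_qcol_eq`): a negative
colouring has a rainbow 2- or 3-MATCHING as monochromatic set (`small_of_isNeg`), on the class of a 2-set `{e,f}` the weight is
`2·[e,f same colour] − [different]` (`qcol_of_pair`), on a 3-set `3q` is the sum of the three pair weights (`three_qcol_of_triple`); hence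
`3q(σ) = 6·[σ ∈ A*] + [M(σ) a 2-matching]·3·pairVal + [M(σ) a 3-matching]·Σ_{pairs} pairVal`, with `A*` the positive colourings whose
monochromatic set is not a small matching.  The companion file sums this with the Kempe pair lemma to the KEMPE IDENTITY.
-/

namespace Summit.CriticalPhenomena.PercolationContinuityZ3.Theorems.SunflowerPartition.Kempe

open Finset
open scoped Classical

variable {V : Type*} [Fintype V] (G : SimpleGraph V)

/-! ## Monochromatic edges, colour counts and the Lemma-B functional in colouring language -/

/-- The edge set of `G` as a finset of unordered pairs. [this work] -/
noncomputable def edges : Finset (Sym2 V) := univ.filter fun e => e ∈ G.edgeSet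

/-- The monochromatic edges of colour `c` under the (improper) colouring `σ`. [this work] -/
noncomputable def monoCol (σ : V → Fin 3) (c : Fin 3) : Finset (Sym2 V) :=
  (edges G).filter fun e => e.map σ = s(c, c)

/-- All monochromatic edges of `σ` (the set `M(σ)` of the memos). [this work] -/
noncomputable def monoSet (σ : V → Fin 3) : Finset (Sym2 V) :=
  (edges G).filter fun e => (e.map σ).IsDiag

/-- `cnt σ c = X_c(σ)`, the number of monochromatic edges of colour `c`. [this work] -/
noncomputable def cnt (σ : V → Fin 3) (c : Fin 3) : ℕ := (monoCol G σ c).card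

/-- POSITIVE type `[0,0,2⁺]`: one colour class carries at least two monochromatic edges, the other two none. [this work] -/
def IsPos (σ : V → Fin 3) : Prop := ∃ c, 2 ≤ cnt G σ c ∧ ∀ c', c' ≠ c → cnt G σ c' = 0

/-- NEGATIVE types `[0,1,1]`, `[1,1,1]`: two classes with exactly one monochromatic edge and the third with none, or all three with one. [this work] -/
def IsNeg (σ : V → Fin 3) : Prop :=
  (∃ c, cnt G σ c = 0 ∧ ∀ c', c' ≠ c → cnt G σ c' = 1) ∨ ∀ c, cnt G σ c = 1

/-- The pointwise Lemma-B weight `q(σ) = 2·[002] − [011] − [111]`. [this work] -/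
noncomputable def qcol (σ : V → Fin 3) : ℤ := (if IsPos G σ then 2 else 0) - (if IsNeg G σ then 1 else 0)

/-- The Lemma-B functional of the graph in colouring language, `Q(G) = Σ_σ q(σ)` (= `QKW univ (ofClutter E)` for the edge
family `E` of `G`; that bridge is not in this file). [this work] -/
noncomputable def Qcol : ℤ := ∑ σ : V → Fin 3, qcol G σ

/-! ## Basic facts about monochromatic edges -/

omit [Fintype V] in
/-- `s(u,v)` is an edge iff `u ~ v`. [this work] -/
theorem mk_mem_edgeSet_iff (u v : V) : s(u, v) ∈ G.edgeSet ↔ G.Adj u v := SimpleGraph.mem_edgeSet G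

/-- Membership in `edges`. [this work] -/
theorem mem_edges (e : Sym2 V) : e ∈ edges G ↔ e ∈ G.edgeSet := by
  unfold edges; simp only [mem_filter, mem_univ, true_and]

/-- Membership in `monoSet`. [this work] -/
theorem mem_monoSet (σ : V → Fin 3) (e : Sym2 V) : e ∈ monoSet G σ ↔ e ∈ G.edgeSet ∧ (e.map σ).IsDiag := by
  unfold monoSet; rw [mem_filter, mem_edges]

/-- Membership in `monoCol`. [this work] -/
theorem mem_monoCol (σ : V → Fin 3) (c : Fin 3) (e : Sym2 V) :
    e ∈ monoCol G σ c ↔ e ∈ G.edgeSet ∧ e.map σ = s(c, c) := by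
  unfold monoCol; rw [mem_filter, mem_edges]

omit [Fintype V] in
/-- A pair is monochromatic iff its two ends have the same colour. [this work] -/
theorem map_mk_isDiag_iff (σ : V → Fin 3) (u v : V) : (Sym2.map σ s(u, v)).IsDiag ↔ σ u = σ v := by
  rw [Sym2.map_mk, Sym2.mk_isDiag_iff]

/-- `s(u,v) ∈ monoSet σ` iff `u ~ v` and `σ u = σ v`. [this work] -/
theorem mk_mem_monoSet_iff (σ : V → Fin 3) (u v : V) : s(u, v) ∈ monoSet G σ ↔ G.Adj u v ∧ σ u = σ v := by
  rw [mem_monoSet, mk_mem_edgeSet_iff, map_mk_isDiag_iff]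

/-- `s(u,v) ∈ monoCol σ c` iff `u ~ v` and both ends are coloured `c`. [this work] -/
theorem mk_mem_monoCol_iff (σ : V → Fin 3) (c : Fin 3) (u v : V) :
    s(u, v) ∈ monoCol G σ c ↔ G.Adj u v ∧ σ u = c ∧ σ v = c := by
  rw [mem_monoCol, mk_mem_edgeSet_iff, Sym2.map_mk, Sym2.eq_iff]; tauto

/-- `monoCol σ c ⊆ monoSet σ`, as a filter. [this work] -/
theorem monoCol_eq_filter_monoSet (σ : V → Fin 3) (c : Fin 3) :
    monoCol G σ c = (monoSet G σ).filter fun e => e.map σ = s(c, c) := by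
  ext e
  rw [mem_monoCol, mem_filter, mem_monoSet]
  constructor
  · rintro ⟨h1, h2⟩
    refine ⟨⟨h1, ?_⟩, h2⟩
    rw [h2]; exact (Sym2.mk_isDiag_iff).2 rfl
  · rintro ⟨⟨h1, _⟩, h2⟩
    exact ⟨h1, h2⟩

/-- A monochromatic edge has a colour: `e.map σ = s(c,c)`. [this work] -/
theorem exists_col_of_mem_monoSet {σ : V → Fin 3} {e : Sym2 V} (h : e ∈ monoSet G σ) : ∃ c, e.map σ = s(c, c) := by
  induction e using Sym2.ind with
  | _ u v =>
    obtain ⟨_, hc⟩ := (mk_mem_monoSet_iff G σ u v).1 h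
    exact ⟨σ v, by rw [Sym2.map_mk, hc]⟩

omit [Fintype V] in
/-- `s(a,a) = s(c,c)` iff `a = c`. [this work] -/
theorem diag_eq_diag_iff (a c : Fin 3) : (s(a, a) : Sym2 (Fin 3)) = s(c, c) ↔ a = c := by
  rw [Sym2.eq_iff]; tauto

/-- `monoSet σ ⊆ edges G`. [this work] -/
theorem monoSet_subset_edges (σ : V → Fin 3) : monoSet G σ ⊆ edges G := by
  unfold monoSet; exact filter_subset _ _

/-- With `monoSet σ = M`, the colour count is a filter of `M`. [this work] -/
theorem cnt_eq_card_filter {σ : V → Fin 3} {M : Finset (Sym2 V)} (hM : monoSet G σ = M) (c : Fin 3) :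
    cnt G σ c = (M.filter fun e => e.map σ = s(c, c)).card := by
  unfold cnt; rw [monoCol_eq_filter_monoSet, hM]

/-! ## Colour patterns of two and three monochromatic edges (finite checks) -/

/-- Indicator count of a colour among two colours. [this work] -/
def ind2 (a b c : Fin 3) : ℕ := (if a = c then 1 else 0) + (if b = c then 1 else 0)

/-- Indicator count of a colour among three colours. [this work] -/
def ind3 (a b d c : Fin 3) : ℕ := (if a = c then 1 else 0) + (if b = c then 1 else 0) + (if d = c then 1 else 0)

/-- The pair weight `2·[same] − [different]` of two colours. [this work] -/
def pw (a b : Fin 3) : ℤ := (if a = b then 2 else 0) - (if a ≠ b then 1 else 0)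

/-- Two monochromatic edges: POSITIVE iff equal colours. [this work] -/
theorem pos_ind2 : ∀ a b : Fin 3, (∃ c, 2 ≤ ind2 a b c ∧ ∀ c', c' ≠ c → ind2 a b c' = 0) ↔ a = b := by decide

/-- Two monochromatic edges: NEGATIVE iff different colours. [this work] -/
theorem neg_ind2 : ∀ a b : Fin 3,
    ((∃ c, ind2 a b c = 0 ∧ ∀ c', c' ≠ c → ind2 a b c' = 1) ∨ ∀ c, ind2 a b c = 1) ↔ a ≠ b := by decide

/-- Three monochromatic edges: `3·q` is the sum of the three pair weights. [this work] -/
theorem three_q_ind3 : ∀ a b d : Fin 3,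
    3 * ((if ∃ c, 2 ≤ ind3 a b d c ∧ ∀ c', c' ≠ c → ind3 a b d c' = 0 then (2 : ℤ) else 0)
      - (if (∃ c, ind3 a b d c = 0 ∧ ∀ c', c' ≠ c → ind3 a b d c' = 1) ∨ ∀ c, ind3 a b d c = 1 then 1 else 0))
      = pw a b + pw a d + pw b d := by decide

/-- The three colours. [this work] -/
theorem fin3_cases : ∀ c : Fin 3, c = 0 ∨ c = 1 ∨ c = 2 := by decide

/-- A negative pattern of three counts sums to `2` or `3` and has all counts `≤ 1`. [this work] -/
theorem neg_counts (f : Fin 3 → ℕ) (hf : (∃ c, f c = 0 ∧ ∀ c', c' ≠ c → f c' = 1) ∨ ∀ c, f c = 1) :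
    (f 0 + f 1 + f 2 = 2 ∨ f 0 + f 1 + f 2 = 3) ∧ ∀ c, f c ≤ 1 := by
  rcases hf with ⟨c, hc0, hc1⟩ | hf
  · refine ⟨Or.inl ?_, fun c' => ?_⟩
    · rcases fin3_cases c with rfl | rfl | rfl
      · have h1 := hc1 1 (by decide); have h2 := hc1 2 (by decide); omega
      · have h0 := hc1 0 (by decide); have h2 := hc1 2 (by decide); omega
      · have h0 := hc1 0 (by decide); have h1 := hc1 1 (by decide); omega
    · by_cases h : c' = c
      · rw [h, hc0]; exact Nat.zero_le _
      · rw [hc1 c' h]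
  · exact ⟨Or.inr (by rw [hf 0, hf 1, hf 2]), fun c => (hf c).le⟩

/-! ## Cardinalities of small filters -/

omit [Fintype V] in
/-- Filter of a two-element finset. [this work] -/
theorem card_filter_pair {α : Type*} [DecidableEq α] (p : α → Prop) [DecidablePred p] {a b : α} (h : a ≠ b) :
    (({a, b} : Finset α).filter p).card = (if p a then 1 else 0) + (if p b then 1 else 0) := by
  rw [filter_insert, filter_singleton]
  by_cases ha : p a <;> by_cases hb : p b <;> simp [ha, hb, h]

omit [Fintype V] in
/-- Filter of a three-element finset. [this work] -/
theorem card_filter_triple {α : Type*} [DecidableEq α] (p : α → Prop) [DecidablePred p] {a b d : α}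
    (hab : a ≠ b) (had : a ≠ d) (hbd : b ≠ d) :
    (({a, b, d} : Finset α).filter p).card = (if p a then 1 else 0) + (if p b then 1 else 0) + (if p d then 1 else 0) := by
  have hnot : a ∉ ({b, d} : Finset α).filter p := by
    simp only [mem_filter, mem_insert, mem_singleton, not_and]
    intro h; rcases h with h | h
    · exact (hab h).elim
    · exact (had h).elim
  by_cases ha : p a
  · rw [filter_insert, if_pos ha, card_insert_of_notMem hnot, card_filter_pair p hbd, if_pos ha]; omega
  · rw [filter_insert, if_neg ha, card_filter_pair p hbd, if_neg ha]; omega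

omit [Fintype V] in
/-- The 2-subsets of a three-element finset. [this work] -/
theorem powersetCard_two_triple {α : Type*} [DecidableEq α] {a b d : α} (hab : a ≠ b) (had : a ≠ d) (hbd : b ≠ d) :
    ({a, b, d} : Finset α).powersetCard 2 = {{a, b}, {a, d}, {b, d}} := by
  ext p
  rw [mem_powersetCard]
  simp only [mem_insert, mem_singleton]
  constructor
  · rintro ⟨hsub, hcard⟩
    obtain ⟨x, y, hxy, rfl⟩ := card_eq_two.1 hcard
    have hx : x = a ∨ x = b ∨ x = d := by simpa using hsub (mem_insert_self _ _)
    have hy : y = a ∨ y = b ∨ y = d := by simpa using hsub (mem_insert_of_mem (mem_singleton_self _))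
    rcases hx with rfl | rfl | rfl <;> rcases hy with rfl | rfl | rfl
    all_goals first
      | exact absurd rfl hxy
      | exact Or.inl rfl
      | exact Or.inr (Or.inl rfl)
      | exact Or.inr (Or.inr rfl)
      | exact Or.inl (pair_comm _ _)
      | exact Or.inr (Or.inl (pair_comm _ _))
      | exact Or.inr (Or.inr (pair_comm _ _))
  · rintro (rfl | rfl | rfl)
    · refine ⟨fun x hx => ?_, card_pair hab⟩
      simp only [mem_insert, mem_singleton] at hx ⊢; tauto
    · refine ⟨fun x hx => ?_, card_pair had⟩
      simp only [mem_insert, mem_singleton] at hx ⊢; tauto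
    · refine ⟨fun x hx => ?_, card_pair hbd⟩
      simp only [mem_insert, mem_singleton] at hx ⊢; tauto

omit [Fintype V] in
/-- A sum over the 2-subsets of a three-element finset. [this work] -/
theorem sum_powersetCard_two_triple {α β : Type*} [DecidableEq α] [AddCommMonoid β] (F : Finset α → β) {a b d : α}
    (hab : a ≠ b) (had : a ≠ d) (hbd : b ≠ d) :
    ∑ p ∈ ({a, b, d} : Finset α).powersetCard 2, F p = F {a, b} + F {a, d} + F {b, d} := by
  have hb : b ∉ ({a, d} : Finset α) := by simp [hab.symm, hbd]
  have ha : a ∉ ({b, d} : Finset α) := by simp [hab, had]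
  have h1 : ({a, b} : Finset α) ∉ ({{a, d}, {b, d}} : Finset (Finset α)) := by
    simp only [mem_insert, mem_singleton, not_or]
    exact ⟨fun h => hb (h ▸ mem_insert_of_mem (mem_singleton_self b)), fun h => ha (h ▸ mem_insert_self a _)⟩
  have h2 : ({a, d} : Finset α) ∉ ({{b, d}} : Finset (Finset α)) := by
    rw [mem_singleton]; exact fun h => ha (h ▸ mem_insert_self a _)
  rw [powersetCard_two_triple hab had hbd, sum_insert h1, sum_insert h2, sum_singleton, add_assoc]

/-! ## The monochromatic set determines `q`: two and three monochromatic edges -/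

/-- `#monoSet σ = cnt 0 + cnt 1 + cnt 2`. [this work] -/
theorem card_monoSet_eq (σ : V → Fin 3) : (monoSet G σ).card = cnt G σ 0 + cnt G σ 1 + cnt G σ 2 := by
  have H : ∀ e ∈ monoSet G σ, e.map σ ∈ (univ : Finset (Fin 3)).image (fun c => (s(c, c) : Sym2 (Fin 3))) := by
    intro e he
    obtain ⟨c, hc⟩ := exists_col_of_mem_monoSet G he
    exact mem_image.2 ⟨c, mem_univ _, hc.symm⟩
  rw [card_eq_sum_card_fiberwise H, sum_image]
  · rw [Fin.sum_univ_three, cnt_eq_card_filter G rfl, cnt_eq_card_filter G rfl, cnt_eq_card_filter G rfl]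
  · intro c _ c' _ h; exact (diag_eq_diag_iff c c').1 h

/-- Two monochromatic edges: `q = 2·[same colour] − [different colours]`. [this work] -/
theorem qcol_of_pair {σ : V → Fin 3} {e f : Sym2 V} (hef : e ≠ f) (hM : monoSet G σ = {e, f})
    {a b : Fin 3} (ha : e.map σ = s(a, a)) (hb : f.map σ = s(b, b)) : qcol G σ = pw a b := by
  have hcnt : ∀ c, cnt G σ c = ind2 a b c := fun c => by
    rw [cnt_eq_card_filter G hM, card_filter_pair _ hef, ha, hb, ind2]; simp only [diag_eq_diag_iff]
  unfold qcol IsPos IsNeg pw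
  simp only [hcnt, pos_ind2, neg_ind2]

/-- Three monochromatic edges: `3q` is the sum of the three pair weights. [this work] -/
theorem three_qcol_of_triple {σ : V → Fin 3} {e f g : Sym2 V} (hef : e ≠ f) (heg : e ≠ g) (hfg : f ≠ g)
    (hM : monoSet G σ = {e, f, g}) {a b d : Fin 3} (ha : e.map σ = s(a, a)) (hb : f.map σ = s(b, b))
    (hd : g.map σ = s(d, d)) : 3 * qcol G σ = pw a b + pw a d + pw b d := by
  have hcnt : ∀ c, cnt G σ c = ind3 a b d c := fun c => by
    rw [cnt_eq_card_filter G hM, card_filter_triple _ hef heg hfg, ha, hb, hd, ind3]; simp only [diag_eq_diag_iff]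
  unfold qcol IsPos IsNeg
  simp only [hcnt]
  exact three_q_ind3 a b d

/-- A set of edges is a MATCHING if its members are pairwise vertex-disjoint. [this work] -/
def IsMatching (M : Finset (Sym2 V)) : Prop := ∀ e ∈ M, ∀ f ∈ M, e ≠ f → ∀ v, v ∈ e → v ∉ f

/-- A negative colouring has exactly two or three monochromatic edges, and they are pairwise disjoint
(different colours force disjointness). [this work] -/
theorem small_of_isNeg {σ : V → Fin 3} (h : IsNeg G σ) :
    ((monoSet G σ).card = 2 ∨ (monoSet G σ).card = 3) ∧ IsMatching (monoSet G σ) := by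
  obtain ⟨hsum, hle⟩ := neg_counts (cnt G σ) h
  refine ⟨by rw [card_monoSet_eq]; exact hsum, ?_⟩
  intro e he f hf hef v hve hvf
  obtain ⟨u, rfl⟩ := Sym2.mem_iff_exists.1 hve
  obtain ⟨w, rfl⟩ := Sym2.mem_iff_exists.1 hvf
  obtain ⟨heA, hec⟩ := (mk_mem_monoSet_iff G σ v u).1 he
  obtain ⟨hfA, hfc⟩ := (mk_mem_monoSet_iff G σ v w).1 hf
  have h2 : ({s(v, u), s(v, w)} : Finset (Sym2 V)) ⊆ monoCol G σ (σ v) := by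
    intro x hx
    rcases mem_insert.1 hx with rfl | hx
    · exact (mk_mem_monoCol_iff G σ _ v u).2 ⟨heA, rfl, hec.symm⟩
    · rw [mem_singleton.1 hx]; exact (mk_mem_monoCol_iff G σ _ v w).2 ⟨hfA, rfl, hfc.symm⟩
  have hcard := card_le_card h2
  rw [card_pair hef] at hcard
  have h1 := hle (σ v)
  unfold cnt at h1
  omega

/-! ## `A*`, the small matchings, the classes `F(M)` and the pair weights -/

/-- SMALL MATCHING: the monochromatic set is a 2- or a 3-matching. [this work] -/
def Small (σ : V → Fin 3) : Prop := ((monoSet G σ).card = 2 ∨ (monoSet G σ).card = 3) ∧ IsMatching (monoSet G σ)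

/-- `A*`: the positive colourings whose monochromatic set is not a small matching (non-matching mono sets and
monochromatic matchings with at least four edges). [this work] -/
noncomputable def Astar : Finset (V → Fin 3) := univ.filter fun σ => IsPos G σ ∧ ¬Small G σ

/-- The 2-matchings of `G`. [this work] -/
noncomputable def match2 : Finset (Finset (Sym2 V)) := (edges G).powerset.filter fun M => M.card = 2 ∧ IsMatching M

/-- The 3-matchings of `G`. [this work] -/
noncomputable def match3 : Finset (Finset (Sym2 V)) := (edges G).powerset.filter fun M => M.card = 3 ∧ IsMatching M

/-- The class `F(M)` of colourings whose monochromatic set is exactly `M`. [this work] -/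
noncomputable def fiber (M : Finset (Sym2 V)) : Finset (V → Fin 3) := univ.filter fun σ => monoSet G σ = M

omit [Fintype V] in
/-- All edges of `p` carry the same colour. [this work] -/
def SameOn (σ : V → Fin 3) (p : Finset (Sym2 V)) : Prop := ∀ e ∈ p, ∀ f ∈ p, e.map σ = f.map σ

omit [Fintype V] in
/-- Distinct edges of `p` carry different colour patterns. [this work] -/
def DiffOn (σ : V → Fin 3) (p : Finset (Sym2 V)) : Prop := ∀ e ∈ p, ∀ f ∈ p, e ≠ f → e.map σ ≠ f.map σ

/-- The pair weight `2·[same] − [different]` of a set of (two) edges. [this work] -/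
noncomputable def pairVal (σ : V → Fin 3) (p : Finset (Sym2 V)) : ℤ :=
  (if SameOn σ p then 2 else 0) - (if DiffOn σ p then 1 else 0)

omit [Fintype V] in
/-- `SameOn` on a pair. [this work] -/
theorem sameOn_pair {σ : V → Fin 3} {e f : Sym2 V} : SameOn σ {e, f} ↔ e.map σ = f.map σ := by
  constructor
  · intro h; exact h e (mem_insert_self _ _) f (mem_insert_of_mem (mem_singleton_self _))
  · intro h x hx y hy
    simp only [mem_insert, mem_singleton] at hx hy
    rcases hx with rfl | rfl <;> rcases hy with rfl | rfl <;> first | rfl | exact h | exact h.symm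

omit [Fintype V] in
/-- `DiffOn` on a pair. [this work] -/
theorem diffOn_pair {σ : V → Fin 3} {e f : Sym2 V} (hef : e ≠ f) : DiffOn σ {e, f} ↔ e.map σ ≠ f.map σ := by
  constructor
  · intro h; exact h e (mem_insert_self _ _) f (mem_insert_of_mem (mem_singleton_self _)) hef
  · intro h x hx y hy hxy
    simp only [mem_insert, mem_singleton] at hx hy
    rcases hx with rfl | rfl <;> rcases hy with rfl | rfl <;>
      first | exact absurd rfl hxy | exact h | exact fun h' => h h'.symm

omit [Fintype V] in
/-- The pair weight of two monochromatic edges with colours `a`, `b` is `pw a b`. [this work] -/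
theorem pairVal_pair {σ : V → Fin 3} {e f : Sym2 V} (hef : e ≠ f) {a b : Fin 3} (ha : e.map σ = s(a, a))
    (hb : f.map σ = s(b, b)) : pairVal σ {e, f} = pw a b := by
  unfold pairVal pw
  rw [if_congr sameOn_pair rfl rfl, if_congr (diffOn_pair hef) rfl rfl, ha, hb]
  simp only [ne_eq, diag_eq_diag_iff]

/-- `monoSet σ ∈ match2` iff it is a 2-matching. [this work] -/
theorem monoSet_mem_match2 (σ : V → Fin 3) : monoSet G σ ∈ match2 G ↔ (monoSet G σ).card = 2 ∧ IsMatching (monoSet G σ) := by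
  unfold match2; rw [mem_filter, mem_powerset]; exact ⟨fun h => h.2, fun h => ⟨monoSet_subset_edges G σ, h⟩⟩

/-- `monoSet σ ∈ match3` iff it is a 3-matching. [this work] -/
theorem monoSet_mem_match3 (σ : V → Fin 3) : monoSet G σ ∈ match3 G ↔ (monoSet G σ).card = 3 ∧ IsMatching (monoSet G σ) := by
  unfold match3; rw [mem_filter, mem_powerset]; exact ⟨fun h => h.2, fun h => ⟨monoSet_subset_edges G σ, h⟩⟩

/-- Membership in `A*`. [this work] -/
theorem mem_Astar (σ : V → Fin 3) : σ ∈ Astar G ↔ IsPos G σ ∧ ¬Small G σ := by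
  unfold Astar; rw [mem_filter]; exact ⟨fun h => h.2, fun h => ⟨mem_univ _, h⟩⟩

/-- **POINTWISE NORMAL FORM**: `3q(σ) = 6·[σ ∈ A*] + [M(σ) a 2-matching]·3·(pair weight) + [M(σ) a 3-matching]·Σ_pairs (pair weight)`.
[this work] -/
theorem three_qcol_eq (σ : V → Fin 3) :
    3 * qcol G σ = 6 * (if σ ∈ Astar G then 1 else 0)
      + (if monoSet G σ ∈ match2 G then 3 * pairVal σ (monoSet G σ) else 0)
      + (if monoSet G σ ∈ match3 G then ∑ p ∈ (monoSet G σ).powersetCard 2, pairVal σ p else 0) := by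
  by_cases hS : Small G σ
  · have hA : σ ∉ Astar G := fun h => ((mem_Astar G σ).1 h).2 hS
    rw [if_neg hA, mul_zero, zero_add]
    obtain ⟨h2 | h3, hmat⟩ := hS
    · rw [if_pos ((monoSet_mem_match2 G σ).2 ⟨h2, hmat⟩),
        if_neg (fun h => by have := ((monoSet_mem_match3 G σ).1 h).1; omega), add_zero]
      obtain ⟨e, f, hef, hM⟩ := card_eq_two.1 h2
      obtain ⟨a, ha⟩ := exists_col_of_mem_monoSet G (show e ∈ monoSet G σ by rw [hM]; simp)
      obtain ⟨b, hb⟩ := exists_col_of_mem_monoSet G (show f ∈ monoSet G σ by rw [hM]; simp)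
      rw [hM, qcol_of_pair G hef hM ha hb, pairVal_pair hef ha hb]
    · rw [if_neg (fun h => by have := ((monoSet_mem_match2 G σ).1 h).1; omega),
        if_pos ((monoSet_mem_match3 G σ).2 ⟨h3, hmat⟩), zero_add]
      obtain ⟨e, f, g, hef, heg, hfg, hM⟩ := card_eq_three.1 h3
      obtain ⟨a, ha⟩ := exists_col_of_mem_monoSet G (show e ∈ monoSet G σ by rw [hM]; simp)
      obtain ⟨b, hb⟩ := exists_col_of_mem_monoSet G (show f ∈ monoSet G σ by rw [hM]; simp)
      obtain ⟨d, hd⟩ := exists_col_of_mem_monoSet G (show g ∈ monoSet G σ by rw [hM]; simp)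
      rw [hM, sum_powersetCard_two_triple _ hef heg hfg, three_qcol_of_triple G hef heg hfg hM ha hb hd,
        pairVal_pair hef ha hb, pairVal_pair heg ha hd, pairVal_pair hfg hb hd]
  · have hN : ¬IsNeg G σ := fun h => hS (small_of_isNeg G h)
    rw [if_neg (fun h => hS ((monoSet_mem_match2 G σ).1 h |> fun h' => ⟨Or.inl h'.1, h'.2⟩)),
      if_neg (fun h => hS ((monoSet_mem_match3 G σ).1 h |> fun h' => ⟨Or.inr h'.1, h'.2⟩)), add_zero, add_zero]
    unfold qcol; rw [if_neg hN, sub_zero]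
    by_cases hP : IsPos G σ
    · rw [if_pos hP, if_pos ((mem_Astar G σ).2 ⟨hP, hS⟩)]; norm_num
    · rw [if_neg hP, if_neg (fun h => hP ((mem_Astar G σ).1 h).1)]; norm_num

end Summit.CriticalPhenomena.PercolationContinuityZ3.Theorems.SunflowerPartition.Kempe
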